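import Literature.Analysis.FluidPDE.LerayGaugeStrainSpectrum
import Literature.Analysis.FluidPDE.TaoEnstrophyLocalisation
import Literature.Analysis.FluidPDE.VorticityCalculus
import Summits.NavierStokesRegularity.NavierStokesRegularity.Theorems.TypeICertificateLadderTargetStrainCubeInterpolation
import Summits.NavierStokesRegularity.NavierStokesRegularity.Theorems.TypeICertificateLadderTargetDepletionAlignmentIdentity
import HarnessLib

/-!
# Crux `Target` = `TypeICertificateLadder.NoTypeIBlowup` (stmt-NavierStokesRegularity-1217), line
# `depletion-ladder`: THE `L²` IDENTITIES OF THE STRAIN (`‖S‖₂² = ½‖ω‖₂²`, `‖∇S‖₂² = ½‖∇ω‖₂²`)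

`--supports stmt-NavierStokesRegularity-1217` (fifth file of the seat's proof of the depletion
constant `κ = (√3+√6)/9 < 1/2` in the Tao-slice class, hence RUNG TWO of the amplitude ladder).

For a smooth divergence-free `w : ℝ³ → ℝ³` with strain `sᵢⱼ = ½(∂ⱼwᵢ + ∂ᵢwⱼ)`:

* `sumSq_sym_eq_frobeniusNormSq_sub` — pointwise `Σᵢⱼ sᵢⱼ² = |Dw|²_F − ½‖curl w‖²`;
* `integral_sumSq_sym_eq_half` — `∫ Σᵢⱼ sᵢⱼ² = ½ ∫‖curl w‖²` (from the tree's
  `∫|Dw|²_F = ∫‖curl w‖²`, `SimilarityEnstrophy.integral_norm_curl_sq_eq_integral_frobeniusNormSq`);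
* `curl_fderiv_apply_stdVec` — `curl (∂ₗ v) = ∂ₗ (curl v)`;
* `integral_gradSq_sym_eq_half` — for the strain `s` of `v`: `∫ Σₗᵢⱼ (∂ₗsᵢⱼ)² = ½ ∫|∇ curl v|²_F`
  (the previous identity applied to the divergence-free fields `∂ₗ v`, whose strains are `∂ₗ s`);
* `integral_norm_laplacian_sq_eq` — `∫‖Δv‖² = ∫|∇ curl v|²_F` (`Δv = −curl curl v` and the tree's
  `DepletionLadder.integral_norm_curl_curl_sq_eq`).

WHAT THIS IS NOT: kinematics of one smooth slice; no Navier–Stokes. [folklore]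
-/

noncomputable section

open Set Function Filter Topology MeasureTheory Finset
open scoped RealInnerProductSpace ENNReal NNReal Laplacian ContDiff
open Literature.Analysis.FluidPDE

namespace Summit.NavierStokesRegularity.NavierStokesRegularity.Theorems.DepletionLadder.StrainCube

-- the problem directory repeats the summit name (`NavierStokesRegularity/NavierStokesRegularity`)
set_option linter.dupNamespace false

open Summit.NavierStokesRegularity.NavierStokesRegularity.Theorems.SimilarityEnstrophy
open Summit.NavierStokesRegularity.NavierStokesRegularity.Theorems.RungReynoldsOne.WeightedSlice

variable {v : EuclideanSpace ℝ (Fin 3) → EuclideanSpace ℝ (Fin 3)}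
  {s : Fin 3 → Fin 3 → EuclideanSpace ℝ (Fin 3) → ℝ}

/-! ## Bridges between the coordinate gradient and the tree's `stdMatrix`, `curl`, `frobeniusNormSq` -/

/-- `∂ⱼvᵢ(x)` is the `(i,j)` entry of the tree's velocity-gradient matrix `stdMatrix (Dv(x))`.
[folklore] -/
theorem grad_eq_stdMatrix (hv : ContDiff ℝ ∞ v) (i j : Fin 3) (x : EuclideanSpace ℝ (Fin 3)) :
    pderiv j (fun y => v y i) x =
      stdMatrix (fderiv ℝ v x : EuclideanSpace ℝ (Fin 3) →ₗ[ℝ] EuclideanSpace ℝ (Fin 3)) i j := by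
  rw [stdMatrix_apply, ContinuousLinearMap.coe_coe, grad_eq_fderiv_apply hv]

/-- `|Dv(x)|²_F = Σᵢⱼ (∂ⱼvᵢ(x))²`. [folklore] -/
theorem frobeniusNormSq_eq_sum_grad_sq (hv : ContDiff ℝ ∞ v) (x : EuclideanSpace ℝ (Fin 3)) :
    frobeniusNormSq (fderiv ℝ v x) = ∑ i, ∑ j, pderiv j (fun y => v y i) x ^ 2 := by
  rw [frobeniusNormSq_eq_sum_sq_stdMatrix]
  simp only [grad_eq_stdMatrix hv]

/-- The components of `curl v` in terms of `gᵢⱼ = ∂ⱼvᵢ`. [folklore] -/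
theorem curl_apply_eq (hv : ContDiff ℝ ∞ v) (x : EuclideanSpace ℝ (Fin 3)) :
    curl v x 0 = pderiv 1 (fun y => v y 2) x - pderiv 2 (fun y => v y 1) x ∧
      curl v x 1 = pderiv 2 (fun y => v y 0) x - pderiv 0 (fun y => v y 2) x ∧
      curl v x 2 = pderiv 0 (fun y => v y 1) x - pderiv 1 (fun y => v y 0) x := by
  simp only [grad_eq_fderiv_apply hv, curl, stdVec]
  refine ⟨?_, ?_, ?_⟩ <;> simp

/-- `‖curl v(x)‖² = Σₖ (curl v (x))ₖ²`. [folklore] -/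
theorem norm_curl_sq_eq (x : EuclideanSpace ℝ (Fin 3)) : ‖curl v x‖ ^ 2 = ∑ k, curl v x k ^ 2 :=
  norm_sq_eq_sum_sq _

/-- **Pointwise: `|S|²_F = |Dv|²_F − ½‖curl v‖²`** for the strain `sᵢⱼ = ½(∂ⱼvᵢ + ∂ᵢvⱼ)`. [folklore] -/
theorem sumSq_sym_eq_frobeniusNormSq_sub (hv : ContDiff ℝ ∞ v)
    (hs : ∀ i j y, s i j y = (pderiv j (fun z => v z i) y + pderiv i (fun z => v z j) y) / 2)
    (x : EuclideanSpace ℝ (Fin 3)) :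
    ∑ i, ∑ j, s i j x ^ 2 = frobeniusNormSq (fderiv ℝ v x) - ‖curl v x‖ ^ 2 / 2 := by
  obtain ⟨h0, h1, h2⟩ := curl_apply_eq hv x
  rw [frobeniusNormSq_eq_sum_grad_sq hv, norm_curl_sq_eq,
    sum_sq_sym_eq (fun i j => pderiv j (fun y => v y i) x) (fun i j => s i j x) (fun k => curl v x k)
      (fun i j => hs i j x) h0 h1 h2]

/-! ## `∫ |S|² = ½ ∫ ‖ω‖²` -/

/-- **`∫ Σᵢⱼ sᵢⱼ² = ½ ∫‖curl v‖²`** for a `C^∞` divergence-free field with `v, Dv ∈ L²` and `Dv`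
bounded (so that `|Dv|², ‖curl v‖², (v·∇)v` are integrable and the tree's `∫|Dv|² = ∫‖curl v‖²`
applies). [folklore] -/
theorem integral_sumSq_sym_eq_half (hv : ContDiff ℝ ∞ v) (hdiv : VectorCalculus.IsDivFree v)
    (h0 : ∫⁻ x, ‖iteratedFDeriv ℝ 0 v x‖ₑ ^ 2 < ⊤) (h1 : ∫⁻ x, ‖iteratedFDeriv ℝ 1 v x‖ₑ ^ 2 < ⊤)
    (hs : ∀ i j y, s i j y = (pderiv j (fun z => v z i) y + pderiv i (fun z => v z j) y) / 2) :
    ∫ x, ∑ i, ∑ j, s i j x ^ 2 = (1 / 2) * ∫ x, ‖curl v x‖ ^ 2 := by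
  have hv1 : ContDiff ℝ 1 v := hv.of_le (by norm_cast)
  have hv2 : ContDiff ℝ 2 v := hv.of_le (by norm_cast)
  have cF : Continuous fun x => frobeniusNormSq (fderiv ℝ v x) := by
    unfold frobeniusNormSq
    exact continuous_finsetSum _ fun i _ =>
      (((hv1.continuous_fderiv one_ne_zero).clm_apply continuous_const).norm).pow 2
  have cC : Continuous fun x => ‖curl v x‖ ^ 2 := (continuous_curl hv1).norm.pow 2
  have T1eq : ∀ x, ‖fderiv ℝ v x‖ = ‖iteratedFDeriv ℝ 1 v x‖ := fun x => norm_fderiv_eq_norm_iteratedFDeriv_one x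
  -- integrability
  have iF : Integrable fun x => frobeniusNormSq (fderiv ℝ v x) := by
    refine integrable_of_le_iteratedFDeriv_mul hv h1 h1 cF 9 fun x => ?_
    rw [abs_of_nonneg (frobeniusNormSq_nonneg _), frobeniusNormSq_eq_sum_grad_sq hv]
    have h : ∀ i j, pderiv j (fun y => v y i) x ^ 2 ≤ ‖iteratedFDeriv ℝ 1 v x‖ ^ 2 := fun i j => by
      rw [← sq_abs, ← T1eq]
      exact pow_le_pow_left₀ (abs_nonneg _) (abs_grad_le_norm_fderiv hv i j x) 2
    calc ∑ i, ∑ j, pderiv j (fun y => v y i) x ^ 2 ≤ ∑ _i : Fin 3, ∑ _j : Fin 3, ‖iteratedFDeriv ℝ 1 v x‖ ^ 2 :=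
          sum_le_sum fun i _ => sum_le_sum fun j _ => h i j
      _ = 9 * ‖iteratedFDeriv ℝ 1 v x‖ * ‖iteratedFDeriv ℝ 1 v x‖ := by simp; ring
  have iC : Integrable fun x => ‖curl v x‖ ^ 2 := by
    refine integrable_of_le_iteratedFDeriv_mul hv h1 h1 cC (‖curlCLM‖ ^ 2) fun x => ?_
    rw [abs_of_nonneg (sq_nonneg _), ← T1eq]
    have h := norm_curl_le v x
    have h0' : 0 ≤ ‖curlCLM‖ := norm_nonneg curlCLM
    nlinarith [norm_nonneg (curl v x), norm_nonneg (fderiv ℝ v x)]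
  have iT : Integrable (convect v v) := by
    refine integrable_of_norm_le_const_mul_mul 1 ((hv1.continuous_fderiv one_ne_zero).clm_apply hv.continuous)
      (hv.continuous_iteratedFDeriv (by exact_mod_cast le_top))
      (hv.continuous_iteratedFDeriv (by exact_mod_cast le_top)) h1 h0 fun x => ?_
    rw [convect_apply, one_mul, ← T1eq, norm_iteratedFDeriv_zero]
    exact (fderiv ℝ v x).le_opNorm _
  -- the identity
  have hpt : ∀ x, ∑ i, ∑ j, s i j x ^ 2 = frobeniusNormSq (fderiv ℝ v x) - (1 / 2) * ‖curl v x‖ ^ 2 :=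
    fun x => by rw [sumSq_sym_eq_frobeniusNormSq_sub hv hs x]; ring
  simp_rw [hpt]
  rw [integral_sub iF (iC.const_mul _), integral_const_mul,
    integral_norm_curl_sq_eq_integral_frobeniusNormSq hv2 hdiv iF iC iT]
  ring


/-! ## `∫ |∇S|² = ½ ∫ |∇ω|²` -/

/-- `curl (∂_c v) = ∂_c (curl v)` for `v ∈ C²`. [folklore] -/
theorem curl_fderiv_apply_const (hv : ContDiff ℝ 2 v) (x c : EuclideanSpace ℝ (Fin 3)) :
    curl (fun y => fderiv ℝ v y c) x = fderiv ℝ (curl v) x c := by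
  rw [curl_eq_curlCLM, fderiv_fderiv_apply_eq hv x c, fderiv_curl hv x]
  rfl

/-- `Σₗ ‖∂ₗ (curl v)‖² = |∇ curl v|²_F`. [folklore] -/
theorem sum_norm_fderiv_curl_sq_eq (x : EuclideanSpace ℝ (Fin 3)) :
    ∑ l, ‖fderiv ℝ (curl v) x (stdVec l)‖ ^ 2 = frobeniusNormSq (fderiv ℝ (curl v) x) := by
  rw [frobeniusNormSq_eq_sum (EuclideanSpace.basisFun (Fin 3) ℝ)]
  simp only [stdVec_eq_basisFun]

/-- The directional derivative field `∂ₗ v` is smooth. [folklore] -/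
theorem contDiff_fderiv_apply_const (hv : ContDiff ℝ ∞ v) (c : EuclideanSpace ℝ (Fin 3)) :
    ContDiff ℝ ∞ (fun y => fderiv ℝ v y c) :=
  ((contDiff_infty_iff_fderiv.1 hv).2).clm_apply contDiff_const

/-- The components of `∂ₗ v` are the coordinate partials `∂ₗ vᵢ`. [folklore] -/
theorem fderiv_apply_stdVec_apply_eq (hv : ContDiff ℝ ∞ v) (l i : Fin 3) :
    (fun y => fderiv ℝ v y (stdVec l) i) = pderiv l fun y => v y i :=
  funext fun y => (grad_eq_fderiv_apply hv i l y).symm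

/-- `‖D(∂ₗv)(x)‖ ≤ ‖D²v(x)‖` and `‖∂ₗv(x)‖ ≤ ‖D¹v(x)‖`. [folklore] -/
theorem norm_fderiv_fderiv_apply_stdVec_le (hv : ContDiff ℝ ∞ v) (l : Fin 3) (x : EuclideanSpace ℝ (Fin 3)) :
    ‖fderiv ℝ (fun y => fderiv ℝ v y (stdVec l)) x‖ ≤ ‖iteratedFDeriv ℝ 2 v x‖ ∧
      ‖fderiv ℝ v x (stdVec l)‖ ≤ ‖iteratedFDeriv ℝ 1 v x‖ := by
  have hv2 : ContDiff ℝ 2 v := hv.of_le (by norm_cast)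
  have he : ‖(stdVec l : EuclideanSpace ℝ (Fin 3))‖ = 1 := by simp [stdVec]
  constructor
  · rw [fderiv_fderiv_apply_eq hv2 x (stdVec l)]
    calc ‖fderiv ℝ (fderiv ℝ v) x (stdVec l)‖ ≤ ‖fderiv ℝ (fderiv ℝ v) x‖ * ‖(stdVec l : EuclideanSpace ℝ (Fin 3))‖ :=
          (fderiv ℝ (fderiv ℝ v) x).le_opNorm _
      _ = ‖iteratedFDeriv ℝ 2 v x‖ := by
          rw [he, mul_one, ← norm_iteratedFDeriv_fderiv, ← norm_iteratedFDeriv_fderiv,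
            norm_iteratedFDeriv_zero]
  · calc ‖fderiv ℝ v x (stdVec l)‖ ≤ ‖fderiv ℝ v x‖ * ‖(stdVec l : EuclideanSpace ℝ (Fin 3))‖ :=
          (fderiv ℝ v x).le_opNorm _
      _ = ‖iteratedFDeriv ℝ 1 v x‖ := by rw [he, mul_one, norm_fderiv_eq_norm_iteratedFDeriv_one]

/-- **`∫ Σₗᵢⱼ (∂ₗ sᵢⱼ)² = ½ ∫ |∇ curl v|²_F`** for a `C^∞` divergence-free `v` with `D¹v, D²v ∈ L²`:
the strains of the divergence-free fields `∂ₗ v` are `∂ₗ s`, and `curl ∂ₗ v = ∂ₗ curl v`. [folklore] -/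
theorem integral_gradSq_sym_eq_half (hv : ContDiff ℝ ∞ v) (hdiv : VectorCalculus.IsDivFree v)
    (h1 : ∫⁻ x, ‖iteratedFDeriv ℝ 1 v x‖ₑ ^ 2 < ⊤) (h2 : ∫⁻ x, ‖iteratedFDeriv ℝ 2 v x‖ₑ ^ 2 < ⊤)
    (hs : ∀ i j y, s i j y = (pderiv j (fun z => v z i) y + pderiv i (fun z => v z j) y) / 2) :
    ∫ x, ∑ l, ∑ i, ∑ j, pderiv l (s i j) x ^ 2 =
      (1 / 2) * ∫ x, frobeniusNormSq (fderiv ℝ (curl v) x) := by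
  have hv2 : ContDiff ℝ 2 v := hv.of_le (by norm_cast)
  -- the fields `w l = ∂ₗ v`
  set w : Fin 3 → EuclideanSpace ℝ (Fin 3) → EuclideanSpace ℝ (Fin 3) :=
    fun l y => fderiv ℝ v y (stdVec l) with hw
  have hwC : ∀ l, ContDiff ℝ ∞ (w l) := fun l => contDiff_fderiv_apply_const hv (stdVec l)
  have hwdiv : ∀ l, VectorCalculus.IsDivFree (w l) := fun l =>
    VectorCalculus.IsDivFree.fderiv_apply hv2 hdiv (stdVec l)
  -- Sobolev data of `w l`: `D⁰(w l), D¹(w l) ∈ L²`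
  have hw0 : ∀ l, ∫⁻ x, ‖iteratedFDeriv ℝ 0 (w l) x‖ₑ ^ 2 < ⊤ := fun l => by
    refine lintegral_enorm_sq_lt_top_of_norm_le_const_mul 1 (fun x => ?_) h1
    rw [norm_iteratedFDeriv_zero, one_mul]
    exact (norm_fderiv_fderiv_apply_stdVec_le hv l x).2
  have hw1 : ∀ l, ∫⁻ x, ‖iteratedFDeriv ℝ 1 (w l) x‖ₑ ^ 2 < ⊤ := fun l => by
    refine lintegral_enorm_sq_lt_top_of_norm_le_const_mul 1 (fun x => ?_) h2
    rw [← norm_fderiv_eq_norm_iteratedFDeriv_one, one_mul]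
    exact (norm_fderiv_fderiv_apply_stdVec_le hv l x).1
  -- the strain of `w l` is `∂ₗ s`
  have hsl : ∀ l i j y, pderiv l (s i j) y =
      (pderiv j (fun z => w l z i) y + pderiv i (fun z => w l z j) y) / 2 := by
    intro l i j y
    rw [pderiv_sym_eq hv hs l i j y]
    simp only [hw, fderiv_apply_stdVec_apply_eq hv]
    rw [pderiv_comm (contDiff_apply_of hv i) l j, pderiv_comm (contDiff_apply_of hv j) l i]
  -- apply `∫ |S|² = ½ ∫ ‖curl‖²` to each `w l`
  have hl : ∀ l, ∫ x, ∑ i, ∑ j, pderiv l (s i j) x ^ 2 = (1 / 2) * ∫ x, ‖curl (w l) x‖ ^ 2 :=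
    fun l => integral_sumSq_sym_eq_half (s := fun i j => pderiv l (s i j)) (hwC l) (hwdiv l) (hw0 l)
      (hw1 l) (hsl l)
  -- `curl (w l) = ∂ₗ curl v`
  have hcurl : ∀ l x, curl (w l) x = fderiv ℝ (curl v) x (stdVec l) := fun l x =>
    curl_fderiv_apply_const hv2 x (stdVec l)
  -- integrability of each `‖∂ₗ curl v‖²`
  have hω1 : ContDiff ℝ 1 (curl v) := contDiff_one_curl_of_contDiff_two hv2
  have iC : ∀ l, Integrable fun x => ‖fderiv ℝ (curl v) x (stdVec l)‖ ^ 2 := by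
    intro l
    refine integrable_of_le_iteratedFDeriv_mul hv h2 h2
      ((((hω1.continuous_fderiv one_ne_zero).clm_apply continuous_const).norm).pow 2)
      (‖curlCLM‖ ^ 2) fun x => ?_
    rw [abs_of_nonneg (sq_nonneg _)]
    have he : ‖(stdVec l : EuclideanSpace ℝ (Fin 3))‖ = 1 := by simp [stdVec]
    have h := (fderiv ℝ (curl v) x).le_opNorm (stdVec l)
    rw [he, mul_one] at h
    have h' := norm_fderiv_curl_le hv2 x
    have h0' : 0 ≤ ‖curlCLM‖ := norm_nonneg curlCLM
    nlinarith [norm_nonneg (fderiv ℝ (curl v) x (stdVec l)), norm_nonneg (fderiv ℝ (curl v) x),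
      norm_nonneg (iteratedFDeriv ℝ 2 v x), mul_le_mul h' h' (norm_nonneg _) (by positivity)]
  rw [integral_finsetSum _ (fun l _ => ?_)]
  · simp_rw [hl, hcurl]
    rw [← Finset.mul_sum, ← integral_finsetSum _ (fun l _ => iC l)]
    congr 1
    exact integral_congr_ae (Eventually.of_forall fun x => sum_norm_fderiv_curl_sq_eq x)
  · -- integrability of `Σᵢⱼ (∂ₗ sᵢⱼ)²`
    have hsC := contDiff_sym hv hs
    refine integrable_of_le_iteratedFDeriv_mul hv h2 h2
      (continuous_finsetSum _ fun i _ => continuous_finsetSum _ fun j _ =>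
        ((contDiff_pderiv (hsC i j) l).continuous).pow 2) 9 fun x => ?_
    rw [abs_of_nonneg (sumSq_nonneg (s := fun i j y => pderiv l (s i j) y) x)]
    have h : ∀ i j, pderiv l (s i j) x ^ 2 ≤ ‖iteratedFDeriv ℝ 2 v x‖ ^ 2 := fun i j => by
      rw [← sq_abs]; exact pow_le_pow_left₀ (abs_nonneg _) (abs_pderiv_sym_le hv hs l i j x) 2
    calc ∑ i, ∑ j, pderiv l (s i j) x ^ 2 ≤ ∑ _i : Fin 3, ∑ _j : Fin 3, ‖iteratedFDeriv ℝ 2 v x‖ ^ 2 :=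
          sum_le_sum fun i _ => sum_le_sum fun j _ => h i j
      _ = 9 * ‖iteratedFDeriv ℝ 2 v x‖ * ‖iteratedFDeriv ℝ 2 v x‖ := by simp; ring

/-! ## `∫ ‖Δv‖² = ∫ |∇ω|²` -/

/-- **`∫‖Δv‖² = ∫|∇ curl v|²_F`** for a `C^∞` divergence-free `v` with `D¹v, D²v ∈ L²`
(`Δv = −curl curl v`, then the tree's `∫‖curl ω‖² = ∫|∇ω|²_F`). [folklore] -/
theorem integral_norm_laplacian_sq_eq (hv : ContDiff ℝ ∞ v) (hdiv : VectorCalculus.IsDivFree v)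
    (h1 : ∫⁻ x, ‖iteratedFDeriv ℝ 1 v x‖ₑ ^ 2 < ⊤) (h2 : ∫⁻ x, ‖iteratedFDeriv ℝ 2 v x‖ₑ ^ 2 < ⊤) :
    ∫ x, ‖(Δ v) x‖ ^ 2 = ∫ x, frobeniusNormSq (fderiv ℝ (curl v) x) := by
  have hv1 : ContDiff ℝ 1 v := hv.of_le (by norm_cast)
  have hv2 : ContDiff ℝ 2 v := hv.of_le (by norm_cast)
  have hv3 : ContDiff ℝ 3 v := hv.of_le (by norm_cast)
  have hω1 : ContDiff ℝ 1 (curl v) := contDiff_one_curl_of_contDiff_two hv2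
  have hpt : ∀ x, ‖(Δ v) x‖ ^ 2 = ‖curl (curl v) x‖ ^ 2 := fun x => by
    rw [laplacian_eq_neg_curl_curl hv2 hdiv x, norm_neg]
  simp_rw [hpt]
  -- integrability inputs of the tree lemma
  have iZ : Integrable fun x => ‖curl v x‖ ^ 2 := by
    refine integrable_of_le_iteratedFDeriv_mul hv h1 h1 ((continuous_curl hv1).norm.pow 2)
      (‖curlCLM‖ ^ 2) fun x => ?_
    rw [abs_of_nonneg (sq_nonneg _), ← norm_fderiv_eq_norm_iteratedFDeriv_one]
    have h := norm_curl_le v x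
    have h0' : 0 ≤ ‖curlCLM‖ := norm_nonneg curlCLM
    nlinarith [norm_nonneg (curl v x), norm_nonneg (fderiv ℝ v x)]
  have iA : Integrable fun x => frobeniusNormSq (fderiv ℝ (curl v) x) := by
    have cF : Continuous fun x => frobeniusNormSq (fderiv ℝ (curl v) x) := by
      unfold frobeniusNormSq
      exact continuous_finsetSum _ fun i _ =>
        (((hω1.continuous_fderiv one_ne_zero).clm_apply continuous_const).norm).pow 2
    refine integrable_of_le_iteratedFDeriv_mul hv h2 h2 cF (3 * ‖curlCLM‖ ^ 2) fun x => ?_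
    rw [abs_of_nonneg (frobeniusNormSq_nonneg _), ← sum_norm_fderiv_curl_sq_eq]
    have h' := norm_fderiv_curl_le hv2 x
    have hl : ∀ l, ‖fderiv ℝ (curl v) x (stdVec l)‖ ^ 2 ≤ (‖curlCLM‖ * ‖iteratedFDeriv ℝ 2 v x‖) ^ 2 := by
      intro l
      have he : ‖(stdVec l : EuclideanSpace ℝ (Fin 3))‖ = 1 := by simp [stdVec]
      have h := (fderiv ℝ (curl v) x).le_opNorm (stdVec l)
      rw [he, mul_one] at h
      exact pow_le_pow_left₀ (norm_nonneg _) (h.trans h') 2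
    calc ∑ l, ‖fderiv ℝ (curl v) x (stdVec l)‖ ^ 2 ≤ ∑ _l : Fin 3, (‖curlCLM‖ * ‖iteratedFDeriv ℝ 2 v x‖) ^ 2 :=
          sum_le_sum fun l _ => hl l
      _ = 3 * ‖curlCLM‖ ^ 2 * ‖iteratedFDeriv ℝ 2 v x‖ * ‖iteratedFDeriv ℝ 2 v x‖ := by simp; ring
  exact integral_norm_curl_curl_sq_eq hv3 iZ iA

end Summit.NavierStokesRegularity.NavierStokesRegularity.Theorems.DepletionLadder.StrainCube

end
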